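import Summits.QuantumFields.BalabanUV.Beta.GAN24.SawtoothSlotCalculus

/-!
# `BalabanUV.Beta.GAN24.SawtoothCommutatorCharge` — binder row G-an2-4 ∕ (CONV-C), row (C) at the levels `j ≥ 1`, CONTACT side; Part 12 of
# `GAN24/FourFaceGaugeSectors`: **THE CELL SAWTOOTH AGAINST THE (COLUMN − ROW) READ IS THE COMMUTATOR CHARGE WITH THE PERIODIC SAWTOOTH** — for a
# bi-localised, jointly `N`-covariant slot family `K v x z` of leg entries,
# `Σ_{y₀∈box N} (y₀)_κ·Σ'_v (dλ_{κ′})_{κ′}(v)·Σ'_{xz} K v x z·(½[z = toSite y₀] − ½[x = toSite y₀]) = Σ_{v₀∈box N} (dλ_{κ′})_{κ′}(toSite v₀)·Σ'_{xz} K (toSite v₀) x z·½(λ_κ(z) − λ_κ(x))`,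
# `λ_κ(w) = w_κ % N` — the output shape of Part 11 (`BackgroundPairSectorSiteLawSym`) turned into the input shape of leaf-06's cubic gauge letter L1 ∕ L1′
# (the pure table's slot slice COMMUTED with the periodic block sawtooth, ff charge, the sawtooth gradient on the slot over ONE cell)

NOT IN PRINT; OUR BOOKKEEPING (G-an2-4 crux team (2), leaf prover `b2b-balaban-gan24-formalise-leaf-02`, gen 65; journal INTENT I-leaf02-g65-5).  WHY.  Part 11
leaves the leg-symmetrised background-pair contact sector of `T2RecAt (j+1)` as `Σ_{y₀∈cell} (y₀)_κ·Σ'_v (dλ_{κ′})_{κ′}(v)·Σ'_{xz} S(v)(x,z)·(½[z = y₀] − ½[x = y₀])`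
(`S(v)` = the leg-symmetrised ff slice of `SpureRecAt (j+1) κ′ v`): the cell sawtooth on the DIVERGENCE site against the (column − row) read of the slice.  The
letter that values it (leaf-06's `CubicBackgroundGaugeLetter` ∕ `CubicGaugeLetterLinearGrowth`) speaks of the slice's COMMUTATOR with a gauge function on the
legs.  The same cell–slot exchange as in Part 9 (`SawtoothSlotCalculus.sum_box_tsum_exchange`; here the two slots are the divergence∕leg site `y` and the table
slot `v`, jointly `N`-covariant because the slice family is) moves the cell onto the table slot and the lattice sum onto the leg site, where the sawtooth-weighted
(column − row) read IS the commutator charge `Σ'_{xz} K x z·(λ(z) − λ(x))` (Fubini; `λ` bounded, legs absolutely summable).  So the contact value becomes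
`½·Σ_{v₀∈cell} (dλ_{κ′})_{κ′}(v₀)·charge([K(v₀), Λ_κ])` with the PERIODIC sawtooth `Λ_κ` — no cell restriction left on the gauge function.

WHAT (generic `d`, `1 ≤ N`; a scalar slot family `K : Site → Site → Site → ℝ` with the bi-localised bound `|K v x z| ≤ C·e^{−δ(|x−v|₁+|z−v|₁)}`, `0 < δ`, and — where
said — the joint covariance `K (v + N•t) (x + N•t) (z + N•t) = K v x z`; [folklore] re-indexing, one-point sums, Fubini; 0 `def`, 0 cited facts, 0 `def … : Prop`, 0 sorry):
* §1 `summable_legs_of_bound`, `summable_colPair_of_bound` ∕ `summable_rowPair_of_bound` (shear `(v,x) ↦ (v, x − v)`), **`tsum_tsum_mul_halfInd`** (the one-point sums: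
  `Σ'_{xz} K v x z·(½[z = y₀] − ½[x = y₀]) = ½(Σ'_x K v x y₀ − Σ'_z K v y₀ z)`).
* §2 `col_translate` ∕ `row_translate` (joint covariance of the column ∕ row reads), **`sum_box_saw_colRow_exchange`** (the exchange: cell on the leg site ×
  lattice on the slot ⟶ cell on the slot × lattice on the leg site).
* §3 **`tsum_saw_mul_colRow_eq_commutator`** (`Σ'_y λ(y_κ)·(Σ'_x K x y − Σ'_z K y z) = Σ'_{xz} K x z·(λ(z_κ) − λ(x_κ))`).
* §4 **`sum_box_saw_halfInd_eq_commutator`** — the displayed identity.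
HONEST FRAMING (cell contract, verbatim): «discharging `BetaPertH` makes Bałaban's UV stability UNCONDITIONAL — a real constructive-QFT result; it is NOT the
continuum limit and NOT the Clay problem.»  HONEST DEPENDENCY (verbatim): «continuum YM on T⁴ ⇐ BetaPertH ∧ nine spine estimates (0/9 proved); BetaPertH ⇐ (D1)
∧ (D4) ∧ CAP+tail; G-an2-4 gates asym, D1 and NE2/3/4.»  Bookkeeping only: NO Ward content, NO estimate of Bałaban's; discharges NOTHING of (C) ∕ (C)sym ∕ (Q-L) ∕
«T2Shape» ∕ «T2Drift» ∕ (hW, hWall); 0 wall binders; NEVER «G-an2-4 closed» as (CONV-C); NOT D1, NOT BetaPertH, NOT continuum, NOT Clay.  2026-08-23.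
-/

noncomputable section

open Finset
open scoped BigOperators
open Literature.MathematicalPhysics.QuantumFieldTheory
open Literature.MathematicalPhysics.QuantumFieldTheory.Balaban1983to89
open Literature.MathematicalPhysics.QuantumFieldTheory.Balaban1983to89.Beta
open B12Sec2to5 (l1 l1_nonneg)
open ExpKernelCalculus (summable_exp_shift summable_exp_shift' l1_sub_symm)
open AffineAveraging (Site box toSite)
open Summit.QuantumFields.BalabanUV.Beta.GAN24.CoarseGaugeSourceResponse (summable_bdd_mul)
open Summit.QuantumFields.BalabanUV.Beta.GAN24.SawtoothSlotCalculus (sum_box_tsum_exchange abs_saw_le abs_sawGrad_le emod_add_zsmul_apply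
  toSite_emod_of_mem_box)

namespace Summit.QuantumFields.BalabanUV.Beta.GAN24.SawtoothCommutatorCharge

variable {d : ℕ} {N : ℕ} {K : Site (d + 1) → Site (d + 1) → Site (d + 1) → ℝ} {C δ : ℝ}

/-! ## §1 Summability of the legs and of the column ∕ row pairs; the one-point sums -/

/-- [folklore] The leg pair of one slot is summable on the product lattice (dominated by `C·e^{−δ|x−v|}·e^{−δ|z−v|}`). -/
theorem summable_legs_of_bound (hK : ∀ v x z, |K v x z| ≤ C * Real.exp (-δ * (l1 (x - v) + l1 (z - v)))) (hδ : 0 < δ) (v : Site (d + 1)) :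
    Summable fun q : Site (d + 1) × Site (d + 1) => K v q.1 q.2 := by
  have h1 : Summable fun x : Site (d + 1) => Real.exp (-δ * l1 (x - v)) := summable_exp_shift' hδ v
  have h2 := h1.mul_of_nonneg h1 (fun _ => (Real.exp_pos _).le) (fun _ => (Real.exp_pos _).le)
  refine Summable.of_norm_bounded (h2.mul_left C) fun q => ?_
  rw [Real.norm_eq_abs]
  calc |K v q.1 q.2| ≤ C * Real.exp (-δ * (l1 (q.1 - v) + l1 (q.2 - v))) := hK v q.1 q.2
    _ = C * (Real.exp (-δ * l1 (q.1 - v)) * Real.exp (-δ * l1 (q.2 - v))) := by rw [mul_add, Real.exp_add]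

/-- [folklore] The (slot, first leg) pair at fixed second leg is summable on the product lattice (shear `(v, x) ↦ (v, x − v)`; dominated by
`C·e^{−δ|y₀−v|}·e^{−δ|x−v|}`). -/
theorem summable_colPair_of_bound (hK : ∀ v x z, |K v x z| ≤ C * Real.exp (-δ * (l1 (x - v) + l1 (z - v)))) (hδ : 0 < δ) (y₀ : Site (d + 1)) :
    Summable fun p : Site (d + 1) × Site (d + 1) => K p.1 p.2 y₀ := by
  have h1 : Summable fun v : Site (d + 1) => Real.exp (-δ * l1 (y₀ - v)) := summable_exp_shift hδ y₀
  have h0 : Summable fun x : Site (d + 1) => Real.exp (-δ * l1 x) :=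
    (summable_exp_shift' hδ (0 : Site (d + 1))).congr fun x => by rw [sub_zero]
  have hP := h1.mul_of_nonneg h0 (fun _ => (Real.exp_pos _).le) (fun _ => (Real.exp_pos _).le)
  set e : Site (d + 1) × Site (d + 1) → Site (d + 1) × Site (d + 1) := fun p => (p.1, p.2 - p.1) with he
  have hinj : Function.Injective e := by
    rintro ⟨v, x⟩ ⟨v₁, x₁⟩ h
    simp only [he, Prod.mk.injEq] at h
    obtain ⟨rfl, hx⟩ := h
    rw [sub_left_inj] at hx
    rw [hx]
  have hQ := hP.comp_injective hinj
  refine Summable.of_norm_bounded (hQ.mul_left C) fun p => ?_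
  rw [Real.norm_eq_abs]
  calc |K p.1 p.2 y₀| ≤ C * Real.exp (-δ * (l1 (p.2 - p.1) + l1 (y₀ - p.1))) := hK p.1 p.2 y₀
    _ = C * ((fun q : Site (d + 1) × Site (d + 1) => Real.exp (-δ * l1 (y₀ - q.1)) * Real.exp (-δ * l1 q.2)) ∘ e) p := by
        simp only [Function.comp, he]; rw [mul_add, Real.exp_add]; ring

/-- [folklore] The (slot, second leg) pair at fixed first leg is summable on the product lattice. -/
theorem summable_rowPair_of_bound (hK : ∀ v x z, |K v x z| ≤ C * Real.exp (-δ * (l1 (x - v) + l1 (z - v)))) (hδ : 0 < δ) (y₀ : Site (d + 1)) :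
    Summable fun p : Site (d + 1) × Site (d + 1) => K p.1 y₀ p.2 :=
  summable_colPair_of_bound (K := fun v x z => K v z x) (fun v x z => by rw [add_comm]; exact hK v z x) hδ y₀

/-- [folklore] **THE ONE-POINT SUMS**: for a slot with summable leg pair, `Σ'_{xz} K v x z·(½·[z = y₀] − ½·[x = y₀]) = ½·(Σ'_x K v x y₀ − Σ'_z K v y₀ z)` — the
(column − row) read of the slice at `y₀`. -/
theorem tsum_tsum_mul_halfInd {v : Site (d + 1)} (hs : Summable fun q : Site (d + 1) × Site (d + 1) => K v q.1 q.2) (y₀ : Site (d + 1)) :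
    ∑' x : Site (d + 1), ∑' z : Site (d + 1), K v x z * ((1 : ℝ) / 2 * (if z = y₀ then (1 : ℝ) else 0) - (1 : ℝ) / 2 * (if x = y₀ then (1 : ℝ) else 0))
      = (1 : ℝ) / 2 * ((∑' x : Site (d + 1), K v x y₀) - ∑' z : Site (d + 1), K v y₀ z) := by
  classical
  have hw1 : ∀ q : Site (d + 1) × Site (d + 1), |(1 : ℝ) / 2 * (if q.2 = y₀ then (1 : ℝ) else 0)| ≤ 1 := fun q => by
    split_ifs <;> norm_num [abs_of_nonneg]
  have hw2 : ∀ q : Site (d + 1) × Site (d + 1), |(1 : ℝ) / 2 * (if q.1 = y₀ then (1 : ℝ) else 0)| ≤ 1 := fun q => by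
    split_ifs <;> norm_num [abs_of_nonneg]
  have hA : Summable fun q : Site (d + 1) × Site (d + 1) => K v q.1 q.2 * ((1 : ℝ) / 2 * (if q.2 = y₀ then (1 : ℝ) else 0)) :=
    (summable_bdd_mul hs hw1).congr fun q => mul_comm _ _
  have hB : Summable fun q : Site (d + 1) × Site (d + 1) => K v q.1 q.2 * ((1 : ℝ) / 2 * (if q.1 = y₀ then (1 : ℝ) else 0)) :=
    (summable_bdd_mul hs hw2).congr fun q => mul_comm _ _
  have eFG : (∑' x : Site (d + 1), ∑' z : Site (d + 1), (K v x z * ((1 : ℝ) / 2 * (if z = y₀ then (1 : ℝ) else 0))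
        - K v x z * ((1 : ℝ) / 2 * (if x = y₀ then (1 : ℝ) else 0))))
      = ∑' q : Site (d + 1) × Site (d + 1), (K v q.1 q.2 * ((1 : ℝ) / 2 * (if q.2 = y₀ then (1 : ℝ) else 0))
        - K v q.1 q.2 * ((1 : ℝ) / 2 * (if q.1 = y₀ then (1 : ℝ) else 0))) := (hA.sub hB).tsum_prod.symm
  have eF : (∑' q : Site (d + 1) × Site (d + 1), K v q.1 q.2 * ((1 : ℝ) / 2 * (if q.2 = y₀ then (1 : ℝ) else 0)))
      = ∑' x : Site (d + 1), ∑' z : Site (d + 1), K v x z * ((1 : ℝ) / 2 * (if z = y₀ then (1 : ℝ) else 0)) := hA.tsum_prod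
  have eG : (∑' q : Site (d + 1) × Site (d + 1), K v q.1 q.2 * ((1 : ℝ) / 2 * (if q.1 = y₀ then (1 : ℝ) else 0)))
      = ∑' x : Site (d + 1), ∑' z : Site (d + 1), K v x z * ((1 : ℝ) / 2 * (if x = y₀ then (1 : ℝ) else 0)) := hB.tsum_prod
  have e1 : (∑' x : Site (d + 1), ∑' z : Site (d + 1), K v x z * ((1 : ℝ) / 2 * (if z = y₀ then (1 : ℝ) else 0)))
      = (1 : ℝ) / 2 * ∑' x : Site (d + 1), K v x y₀ := by
    have inner : ∀ x : Site (d + 1), ∑' z : Site (d + 1), K v x z * ((1 : ℝ) / 2 * (if z = y₀ then (1 : ℝ) else 0)) = (1 : ℝ) / 2 * K v x y₀ := by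
      intro x
      rw [tsum_eq_single y₀ (fun z hz => by rw [if_neg hz, mul_zero, mul_zero]), if_pos rfl]
      ring
    simp_rw [inner]
    exact tsum_mul_left
  have e2 : (∑' x : Site (d + 1), ∑' z : Site (d + 1), K v x z * ((1 : ℝ) / 2 * (if x = y₀ then (1 : ℝ) else 0)))
      = (1 : ℝ) / 2 * ∑' z : Site (d + 1), K v y₀ z := by
    have inner : ∀ x : Site (d + 1), ∑' z : Site (d + 1), K v x z * ((1 : ℝ) / 2 * (if x = y₀ then (1 : ℝ) else 0))
        = ((1 : ℝ) / 2 * (if x = y₀ then (1 : ℝ) else 0)) * ∑' z : Site (d + 1), K v x z := by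
      intro x; rw [tsum_mul_right, mul_comm]
    simp_rw [inner]
    rw [tsum_eq_single y₀ (fun x hx => by rw [if_neg hx, mul_zero, zero_mul]), if_pos rfl, mul_one]
  calc ∑' x : Site (d + 1), ∑' z : Site (d + 1), K v x z * ((1 : ℝ) / 2 * (if z = y₀ then (1 : ℝ) else 0) - (1 : ℝ) / 2 * (if x = y₀ then (1 : ℝ) else 0))
      = ∑' x : Site (d + 1), ∑' z : Site (d + 1), (K v x z * ((1 : ℝ) / 2 * (if z = y₀ then (1 : ℝ) else 0))
          - K v x z * ((1 : ℝ) / 2 * (if x = y₀ then (1 : ℝ) else 0))) := by simp_rw [mul_sub]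
    _ = (∑' x : Site (d + 1), ∑' z : Site (d + 1), K v x z * ((1 : ℝ) / 2 * (if z = y₀ then (1 : ℝ) else 0)))
          - ∑' x : Site (d + 1), ∑' z : Site (d + 1), K v x z * ((1 : ℝ) / 2 * (if x = y₀ then (1 : ℝ) else 0)) := by
        rw [eFG, hA.tsum_sub hB, eF, eG]
    _ = _ := by rw [e1, e2]; ring

/-! ## §2 Joint covariance of the column ∕ row reads; the cell–slot exchange -/

section Cov

variable (hKt : ∀ v x z t : Site (d + 1), K (v + (N : ℤ) • t) (x + (N : ℤ) • t) (z + (N : ℤ) • t) = K v x z)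
include hKt

/-- [folklore] The column read is jointly `N`-invariant in (slot, leg site). -/
theorem col_translate (v y t : Site (d + 1)) :
    ∑' x : Site (d + 1), K (v + (N : ℤ) • t) x (y + (N : ℤ) • t) = ∑' x : Site (d + 1), K v x y := by
  rw [← (Equiv.addRight ((N : ℤ) • t)).tsum_eq (fun x : Site (d + 1) => K (v + (N : ℤ) • t) x (y + (N : ℤ) • t))]
  simp only [Equiv.coe_addRight, hKt]

/-- [folklore] The row read is jointly `N`-invariant in (slot, leg site). -/
theorem row_translate (v y t : Site (d + 1)) :
    ∑' z : Site (d + 1), K (v + (N : ℤ) • t) (y + (N : ℤ) • t) z = ∑' z : Site (d + 1), K v y z := by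
  rw [← (Equiv.addRight ((N : ℤ) • t)).tsum_eq (fun z : Site (d + 1) => K (v + (N : ℤ) • t) (y + (N : ℤ) • t) z)]
  simp only [Equiv.coe_addRight, hKt]

end Cov

/-- NOT IN PRINT; OUR BOOKKEEPING.  **THE EXCHANGE FOR THE (COLUMN − ROW) READ** (`1 ≤ N`; bi-localised, jointly `N`-covariant slot family): the cell on the leg
site with the sawtooth `(y₀)_κ` and the lattice on the slot with its sawtooth gradient become the cell on the slot and the lattice on the leg site with the
periodic sawtooth `λ(y_κ) = y_κ % N`:
`Σ_{y₀∈box} (y₀)_κ·Σ'_v (1 − N·[v_{κ′} % N = N−1])·½(Σ'_x K v x (toSite y₀) − Σ'_z K v (toSite y₀) z)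
 = Σ_{v₀∈box} (1 − N·[(toSite v₀)_{κ′} % N = N−1])·Σ'_y λ(y_κ)·½(Σ'_x K (toSite v₀) x y − Σ'_z K (toSite v₀) y z)`. -/
theorem sum_box_saw_colRow_exchange [NeZero N] (hK : ∀ v x z, |K v x z| ≤ C * Real.exp (-δ * (l1 (x - v) + l1 (z - v)))) (hδ : 0 < δ)
    (hKt : ∀ v x z t : Site (d + 1), K (v + (N : ℤ) • t) (x + (N : ℤ) • t) (z + (N : ℤ) • t) = K v x z) (κ κ' : Fin (d + 1)) :
    ∑ yy ∈ box (d + 1) N, ((yy κ : ℕ) : ℝ) * ∑' v : Site (d + 1), (1 - (N : ℝ) * (if v κ' % (N : ℤ) = (N : ℤ) - 1 then (1 : ℝ) else 0))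
        * ((1 : ℝ) / 2 * ((∑' x : Site (d + 1), K v x (toSite yy)) - ∑' z : Site (d + 1), K v (toSite yy) z))
      = ∑ vv ∈ box (d + 1) N, (1 - (N : ℝ) * (if toSite vv κ' % (N : ℤ) = (N : ℤ) - 1 then (1 : ℝ) else 0))
        * ∑' y : Site (d + 1), (((y κ % (N : ℤ)) : ℤ) : ℝ)
          * ((1 : ℝ) / 2 * ((∑' x : Site (d + 1), K (toSite vv) x y) - ∑' z : Site (d + 1), K (toSite vv) y z)) := by
  have hN : 1 ≤ N := Nat.one_le_iff_ne_zero.mpr (NeZero.ne N)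
  -- the two-slot function `F y v = λ(y_κ)·(dλ_{κ′})_{κ′}(v)·½(col − row)(y, v)`
  have hper : ∀ y v t : Site (d + 1),
      (((( (y + (N : ℤ) • t) κ % (N : ℤ)) : ℤ) : ℝ) * (1 - (N : ℝ) * (if (v + (N : ℤ) • t) κ' % (N : ℤ) = (N : ℤ) - 1 then (1 : ℝ) else 0))
        * ((1 : ℝ) / 2 * ((∑' x : Site (d + 1), K (v + (N : ℤ) • t) x (y + (N : ℤ) • t)) - ∑' z : Site (d + 1), K (v + (N : ℤ) • t) (y + (N : ℤ) • t) z)))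
      = (((y κ % (N : ℤ)) : ℤ) : ℝ) * (1 - (N : ℝ) * (if v κ' % (N : ℤ) = (N : ℤ) - 1 then (1 : ℝ) else 0))
        * ((1 : ℝ) / 2 * ((∑' x : Site (d + 1), K v x y) - ∑' z : Site (d + 1), K v y z)) := by
    intro y v t
    rw [emod_add_zsmul_apply, emod_add_zsmul_apply, col_translate hKt, row_translate hKt]
  have hcs : ∀ y₀ : Site (d + 1), Summable fun v : Site (d + 1) => (∑' x : Site (d + 1), K v x y₀) - ∑' z : Site (d + 1), K v y₀ z :=
    fun y₀ => (summable_colPair_of_bound hK hδ y₀).prod.sub (summable_rowPair_of_bound hK hδ y₀).prod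
  have hcf : ∀ v₀ : Site (d + 1), Summable fun y : Site (d + 1) => (∑' x : Site (d + 1), K v₀ x y) - ∑' z : Site (d + 1), K v₀ y z :=
    fun v₀ => (summable_legs_of_bound hK hδ v₀).prod_symm.prod.sub (summable_legs_of_bound hK hδ v₀).prod
  have h1 : ∀ rr ∈ box (d + 1) N, Summable fun v : Site (d + 1) =>
      (((toSite rr κ % (N : ℤ)) : ℤ) : ℝ) * (1 - (N : ℝ) * (if v κ' % (N : ℤ) = (N : ℤ) - 1 then (1 : ℝ) else 0))
        * ((1 : ℝ) / 2 * ((∑' x : Site (d + 1), K v x (toSite rr)) - ∑' z : Site (d + 1), K v (toSite rr) z)) := fun rr _ =>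
    ((summable_bdd_mul ((hcs (toSite rr)).mul_left ((1 : ℝ) / 2)) (fun v => abs_sawGrad_le N (v κ'))).mul_left
      (((toSite rr κ % (N : ℤ)) : ℤ) : ℝ)).congr fun v => (mul_assoc _ _ _).symm
  have h2 : ∀ vv ∈ box (d + 1) N, Summable fun y : Site (d + 1) =>
      (((y κ % (N : ℤ)) : ℤ) : ℝ) * (1 - (N : ℝ) * (if toSite vv κ' % (N : ℤ) = (N : ℤ) - 1 then (1 : ℝ) else 0))
        * ((1 : ℝ) / 2 * ((∑' x : Site (d + 1), K (toSite vv) x y) - ∑' z : Site (d + 1), K (toSite vv) y z)) := fun vv _ =>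
    ((summable_bdd_mul ((hcf (toSite vv)).mul_left ((1 : ℝ) / 2)) (fun y => abs_saw_le hN (y κ))).mul_left
      (1 - (N : ℝ) * (if toSite vv κ' % (N : ℤ) = (N : ℤ) - 1 then (1 : ℝ) else 0))).congr fun y => by ring
  have hx := sum_box_tsum_exchange (N := N) (fun y v : Site (d + 1) =>
      (((y κ % (N : ℤ)) : ℤ) : ℝ) * (1 - (N : ℝ) * (if v κ' % (N : ℤ) = (N : ℤ) - 1 then (1 : ℝ) else 0))
        * ((1 : ℝ) / 2 * ((∑' x : Site (d + 1), K v x y) - ∑' z : Site (d + 1), K v y z))) hper h1 h2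
  beta_reduce at hx
  -- read the left side off `hx` (sawtooth = coordinate inside the cell) and the right side (pull the slot weight out)
  have eL : ∀ yy ∈ box (d + 1) N, ((yy κ : ℕ) : ℝ) * ∑' v : Site (d + 1), (1 - (N : ℝ) * (if v κ' % (N : ℤ) = (N : ℤ) - 1 then (1 : ℝ) else 0))
        * ((1 : ℝ) / 2 * ((∑' x : Site (d + 1), K v x (toSite yy)) - ∑' z : Site (d + 1), K v (toSite yy) z))
      = ∑' v : Site (d + 1), (((toSite yy κ % (N : ℤ)) : ℤ) : ℝ) * (1 - (N : ℝ) * (if v κ' % (N : ℤ) = (N : ℤ) - 1 then (1 : ℝ) else 0))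
        * ((1 : ℝ) / 2 * ((∑' x : Site (d + 1), K v x (toSite yy)) - ∑' z : Site (d + 1), K v (toSite yy) z)) := by
    intro yy hyy
    rw [← tsum_mul_left]
    refine tsum_congr fun v => ?_
    rw [toSite_emod_of_mem_box hyy, Int.cast_natCast, mul_assoc]
  have eR : ∀ vv : Fin (d + 1) → ℕ, (1 - (N : ℝ) * (if toSite vv κ' % (N : ℤ) = (N : ℤ) - 1 then (1 : ℝ) else 0))
        * (∑' y : Site (d + 1), (((y κ % (N : ℤ)) : ℤ) : ℝ)
          * ((1 : ℝ) / 2 * ((∑' x : Site (d + 1), K (toSite vv) x y) - ∑' z : Site (d + 1), K (toSite vv) y z)))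
      = ∑' y : Site (d + 1), (((y κ % (N : ℤ)) : ℤ) : ℝ) * (1 - (N : ℝ) * (if toSite vv κ' % (N : ℤ) = (N : ℤ) - 1 then (1 : ℝ) else 0))
          * ((1 : ℝ) / 2 * ((∑' x : Site (d + 1), K (toSite vv) x y) - ∑' z : Site (d + 1), K (toSite vv) y z)) := by
    intro vv
    rw [← tsum_mul_left]
    exact tsum_congr fun y => by ring
  rw [Finset.sum_congr rfl eL, hx]
  exact Finset.sum_congr rfl fun vv _ => (eR vv).symm

/-! ## §3 The sawtooth against the (column − row) read is the commutator charge -/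

/-- NOT IN PRINT; OUR BOOKKEEPING.  **FUBINI TO THE COMMUTATOR**: for a slot with summable leg pair and the bounded sawtooth `λ(y_κ) = y_κ % N`,
`Σ'_y λ(y_κ)·(Σ'_x K v x y − Σ'_z K v y z) = Σ'_{xz} K v x z·(λ(z_κ) − λ(x_κ))` — the field–field charge of the commutator `[K(v), Λ_κ]` with the PERIODIC sawtooth. -/
theorem tsum_saw_mul_colRow_eq_commutator (hN : 1 ≤ N) {v : Site (d + 1)} (hs : Summable fun q : Site (d + 1) × Site (d + 1) => K v q.1 q.2)
    (κ : Fin (d + 1)) :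
    ∑' y : Site (d + 1), (((y κ % (N : ℤ)) : ℤ) : ℝ) * ((∑' x : Site (d + 1), K v x y) - ∑' z : Site (d + 1), K v y z)
      = ∑' x : Site (d + 1), ∑' z : Site (d + 1), K v x z * ((((z κ % (N : ℤ)) : ℤ) : ℝ) - (((x κ % (N : ℤ)) : ℤ) : ℝ)) := by
  -- summable pieces
  have hcol : Summable fun y : Site (d + 1) => ∑' x : Site (d + 1), K v x y := hs.prod_symm.prod
  have hrow : Summable fun y : Site (d + 1) => ∑' z : Site (d + 1), K v y z := hs.prod
  have hlcol : Summable fun y : Site (d + 1) => (((y κ % (N : ℤ)) : ℤ) : ℝ) * ∑' x : Site (d + 1), K v x y :=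
    summable_bdd_mul hcol (fun y => abs_saw_le hN (y κ))
  have hlrow : Summable fun y : Site (d + 1) => (((y κ % (N : ℤ)) : ℤ) : ℝ) * ∑' z : Site (d + 1), K v y z :=
    summable_bdd_mul hrow (fun y => abs_saw_le hN (y κ))
  -- the `z`-weighted family on the product and its Fubini
  have hZ : Summable fun q : Site (d + 1) × Site (d + 1) => (((q.2 κ % (N : ℤ)) : ℤ) : ℝ) * K v q.1 q.2 :=
    summable_bdd_mul hs (fun q => abs_saw_le hN (q.2 κ))
  have hX : Summable fun q : Site (d + 1) × Site (d + 1) => (((q.1 κ % (N : ℤ)) : ℤ) : ℝ) * K v q.1 q.2 :=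
    summable_bdd_mul hs (fun q => abs_saw_le hN (q.1 κ))
  have e1 : (∑' y : Site (d + 1), (((y κ % (N : ℤ)) : ℤ) : ℝ) * ∑' x : Site (d + 1), K v x y)
      = ∑' x : Site (d + 1), ∑' z : Site (d + 1), (((z κ % (N : ℤ)) : ℤ) : ℝ) * K v x z := by
    have eA : (∑' y : Site (d + 1), (((y κ % (N : ℤ)) : ℤ) : ℝ) * ∑' x : Site (d + 1), K v x y)
        = ∑' y : Site (d + 1), ∑' x : Site (d + 1), (((y κ % (N : ℤ)) : ℤ) : ℝ) * K v x y := tsum_congr fun y => (tsum_mul_left).symm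
    rw [eA]
    have hZu : Summable (Function.uncurry fun (x z : Site (d + 1)) => (((z κ % (N : ℤ)) : ℤ) : ℝ) * K v x z) := hZ
    exact hZu.tsum_comm
  have e2 : (∑' y : Site (d + 1), (((y κ % (N : ℤ)) : ℤ) : ℝ) * ∑' z : Site (d + 1), K v y z)
      = ∑' x : Site (d + 1), ∑' z : Site (d + 1), (((x κ % (N : ℤ)) : ℤ) : ℝ) * K v x z := tsum_congr fun y => (tsum_mul_left).symm
  have eZ : (∑' x : Site (d + 1), ∑' z : Site (d + 1), (((z κ % (N : ℤ)) : ℤ) : ℝ) * K v x z)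
      = ∑' q : Site (d + 1) × Site (d + 1), (((q.2 κ % (N : ℤ)) : ℤ) : ℝ) * K v q.1 q.2 := hZ.tsum_prod.symm
  have eX : (∑' x : Site (d + 1), ∑' z : Site (d + 1), (((x κ % (N : ℤ)) : ℤ) : ℝ) * K v x z)
      = ∑' q : Site (d + 1) × Site (d + 1), (((q.1 κ % (N : ℤ)) : ℤ) : ℝ) * K v q.1 q.2 := hX.tsum_prod.symm
  have eD : (∑' q : Site (d + 1) × Site (d + 1), ((((q.2 κ % (N : ℤ)) : ℤ) : ℝ) * K v q.1 q.2 - (((q.1 κ % (N : ℤ)) : ℤ) : ℝ) * K v q.1 q.2))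
      = ∑' x : Site (d + 1), ∑' z : Site (d + 1), ((((z κ % (N : ℤ)) : ℤ) : ℝ) * K v x z - (((x κ % (N : ℤ)) : ℤ) : ℝ) * K v x z) :=
    (hZ.sub hX).tsum_prod
  calc ∑' y : Site (d + 1), (((y κ % (N : ℤ)) : ℤ) : ℝ) * ((∑' x : Site (d + 1), K v x y) - ∑' z : Site (d + 1), K v y z)
      = (∑' y : Site (d + 1), (((y κ % (N : ℤ)) : ℤ) : ℝ) * ∑' x : Site (d + 1), K v x y)
          - ∑' y : Site (d + 1), (((y κ % (N : ℤ)) : ℤ) : ℝ) * ∑' z : Site (d + 1), K v y z := by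
        rw [← hlcol.tsum_sub hlrow]; exact tsum_congr fun y => mul_sub _ _ _
    _ = ∑' x : Site (d + 1), ∑' z : Site (d + 1), ((((z κ % (N : ℤ)) : ℤ) : ℝ) * K v x z - (((x κ % (N : ℤ)) : ℤ) : ℝ) * K v x z) := by
        rw [e1, e2, eZ, eX, ← hZ.tsum_sub hX, eD]
    _ = _ := tsum_congr fun x => tsum_congr fun z => by ring

/-! ## §4 Assembled -/

/-- NOT IN PRINT; OUR BOOKKEEPING.  **THE CELL SAWTOOTH AGAINST THE (COLUMN − ROW) READ IS THE COMMUTATOR CHARGE WITH THE PERIODIC SAWTOOTH** (`1 ≤ N`;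
bi-localised, jointly `N`-covariant slot family of leg entries):
`Σ_{y₀∈box N} (y₀)_κ·Σ'_v (1 − N·[v_{κ′} % N = N−1])·Σ'_{xz} K v x z·(½·[z = toSite y₀] − ½·[x = toSite y₀])
 = Σ_{v₀∈box N} (1 − N·[(toSite v₀)_{κ′} % N = N−1])·Σ'_{xz} K (toSite v₀) x z·½(λ(z_κ) − λ(x_κ))`, `λ(m) = m % N`. -/
theorem sum_box_saw_halfInd_eq_commutator [NeZero N] (hK : ∀ v x z, |K v x z| ≤ C * Real.exp (-δ * (l1 (x - v) + l1 (z - v)))) (hδ : 0 < δ)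
    (hKt : ∀ v x z t : Site (d + 1), K (v + (N : ℤ) • t) (x + (N : ℤ) • t) (z + (N : ℤ) • t) = K v x z) (κ κ' : Fin (d + 1)) :
    ∑ yy ∈ box (d + 1) N, ((yy κ : ℕ) : ℝ) * ∑' v : Site (d + 1), (1 - (N : ℝ) * (if v κ' % (N : ℤ) = (N : ℤ) - 1 then (1 : ℝ) else 0))
        * ∑' x : Site (d + 1), ∑' z : Site (d + 1), K v x z * ((1 : ℝ) / 2 * (if z = toSite yy then (1 : ℝ) else 0) - (1 : ℝ) / 2 * (if x = toSite yy then (1 : ℝ) else 0))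
      = ∑ vv ∈ box (d + 1) N, (1 - (N : ℝ) * (if toSite vv κ' % (N : ℤ) = (N : ℤ) - 1 then (1 : ℝ) else 0))
        * ∑' x : Site (d + 1), ∑' z : Site (d + 1), K (toSite vv) x z
          * ((1 : ℝ) / 2 * ((((z κ % (N : ℤ)) : ℤ) : ℝ) - (((x κ % (N : ℤ)) : ℤ) : ℝ))) := by
  classical
  have hN : 1 ≤ N := Nat.one_le_iff_ne_zero.mpr (NeZero.ne N)
  simp_rw [tsum_tsum_mul_halfInd (summable_legs_of_bound hK hδ _)]
  rw [sum_box_saw_colRow_exchange hK hδ hKt κ κ']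
  refine Finset.sum_congr rfl fun vv _ => ?_
  congr 1
  have e : ∀ y : Site (d + 1), (((y κ % (N : ℤ)) : ℤ) : ℝ)
        * ((1 : ℝ) / 2 * ((∑' x : Site (d + 1), K (toSite vv) x y) - ∑' z : Site (d + 1), K (toSite vv) y z))
      = (1 : ℝ) / 2 * ((((y κ % (N : ℤ)) : ℤ) : ℝ) * ((∑' x : Site (d + 1), K (toSite vv) x y) - ∑' z : Site (d + 1), K (toSite vv) y z)) :=
    fun y => by ring
  simp_rw [e]
  rw [tsum_mul_left, tsum_saw_mul_colRow_eq_commutator hN (summable_legs_of_bound hK hδ _) κ, ← tsum_mul_left]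
  refine tsum_congr fun x => ?_
  rw [← tsum_mul_left]
  exact tsum_congr fun z => by ring

end Summit.QuantumFields.BalabanUV.Beta.GAN24.SawtoothCommutatorCharge

end
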